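import Summits.BirchSwinnertonDyer.BirchSwinnertonDyer.Theorems.PrintCf2SplitBadTwoControlCokernelOfFrame
import HarnessLib

/-!
# Crux `PrintCf2.SplitBadTwoRankOneOfFacts` (stmt-BirchSwinnertonDyer-20368), road α v10.3 — S3c `stub_restrictedControl_two`:
# THE CONTROL COKERNEL IS FINITE (`relIndex ≠ 0`), generically and on every frame; hence `𝔖^Γ` is finite AS SOON AS `𝔖_{v̄}(K, W*)` is

Cell `bsd-print-cf2`, LEAD seat `bsd-line-cf2-p1` g12 (prover-bsd-line-cf2-p1-g12-0); `--supports stmt-BirchSwinnertonDyer-20368` (helper,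
Theses-free). HONEST FRAMING: nothing here closes the crux or a registered stub; BSD is not proved by any of this; no summit statement is
proved by this seat. No definition, no named fact, no `sorry`.

WHY. LEAD g11's p658316 `relIndex_le_prod_natCard_localKer` bounds the cokernel of control `[𝔖_𝔮(K_∞, M)^Γ : res 𝔖_𝔮(K, M)]` by the
product of the local kernels — as an inequality of natural numbers. In Mathlib's convention an INFINITE index is `relIndex = 0`, which
satisfies every `≤`; so the landed statement does not by itself yield finiteness of the cokernel, and -w7's
`finite_endInvariants_of_finite_restrictedSelmerBase` (p652120: `𝔖^Γ` finite ⟸ `𝔖_𝔮(K, M)` finite ∧ `relIndex ≠ 0`) could not yet be fed.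
This file closes that gap with the SAME construction (adapted from p658316, credited line by line): the image of `res` inside `𝔖^Γ` contains
the image `g(B)` of a subgroup `B ≤ A = res⁻¹(𝔖^Γ)` of finite index (`A/B ↪ ∏_w LK_w`, finite), so it has finite index
(`AddSubgroup.finiteIndex_of_le`).

* §1 (generic: any number field `K`, any `ℤ_p`-line `κ` with topological generator `γ`, any discrete `p`-primary `M` with continuous orbit
  maps, any place `𝔮`, local kernels vanishing off a finite `T ∌ (p)` and at infinity, finite on `T ∪ {𝔮}`):
  **`relIndex_ne_zero_of_localKer_finite`** — `[𝔖^Γ : res 𝔖_𝔮(K, M)] ≠ 0`; `finite_endInvariants_of_finite_restrictedSelmerBase_of_localKer_finite`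
  — `𝔖_𝔮(K, M)` finite ⟹ `𝔖^Γ` finite.
* §2 (road α, every S3c frame: `C • W = cm7^{(d)}`, `d ≠ 0` squarefree, `K` imaginary quadratic, `v ≠ v̄ ∣ 2`, `π² = π − 2`, `r² = r − 2`,
  `κ'` unramified outside `v̄`, `M = W* = ↥((W.baseChange K).endEigenPrimaryTorsion 2 π r)`): **`relIndex_control_of_frame_ne_zero`** (the
  local inputs are -w3 g7's p660114/`ControlCokernelOfFrame` values and LEAD g11's archimedean vanishing p658763) and
  **`finite_endInvariants_of_frame_of_finite_restrictedSelmerBase`** — on every frame, `𝔖_{v̄}(K*_∞, W*)^Γ` is finite as soon as the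
  bottom group `𝔖_{v̄}(K, W*)` is. So the finiteness conjunct that v9.1–v10.2's S3c₂ carried (and v10.3's S3c no longer does) is EXACTLY the
  level-`K` finiteness of Agboola §6 (Prop. 6.10–6.11: `r = 1` and `Ш(K)(v̄)` finite) — see `Cruxes/…/S3C-LEVELK-POITOU-TATE-TYPING-g12.md`.
presearch: Greenberg LNM 1716 §3 Lemmas 3.1–3.3 (held), Agboola 2007 Prop. 3.2 (held) — no fact filed, nothing new needed.

References: R. Greenberg, LNM 1716 (1999) §3 Lemmas 3.1–3.3 [GreenbergLNM1716]; A. Agboola, Compositio Math. 143 (2007) = arXiv:math/0602192,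
§3 Prop. 3.2, §6 [Agboola2007].
-/

noncomputable section

open scoped Classical

set_option linter.dupNamespace false
set_option autoImplicit false

open NumberField IsDedekindDomain Field WeierstrassCurve
open Literature.NumberTheory.EllipticCurves Literature.NumberTheory.EllipticCurves.GreenbergSelmer
open Literature.NumberTheory.EllipticCurves.Agboola2007
open Literature.NumberTheory.EllipticCurves.IwasawaDual
open Literature.NumberTheory.EllipticCurves.ResKernel
open Literature.NumberTheory.GaloisRepresentations

universe u

namespace Summit.BirchSwinnertonDyer.BirchSwinnertonDyer.Theorems.PrintCf2.RestrictedSelmerPair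

/-! ## §1 Generic: the control cokernel is finite -/

section Coker

variable {K : Type u} [Field K] [NumberField K] {p : ℕ} [Fact p.Prime] (κ : ZpExtension K p)
  (M : Type u) [AddCommGroup M] [DistribMulAction (absoluteGaloisGroup K) M]
  [TopologicalSpace M] [DiscreteTopology M] (𝔮 : HeightOneSpectrum (𝓞 K))

/-- **THE COKERNEL OF CONTROL IS FINITE.** For a `ℤ_p`-line `κ` of a number field `K` with topological generator `γ`, a discrete
`p`-primary `Γ_K`-module `M` with continuous orbit maps, a place `𝔮`, and a finite set `T` of finite places prime to `p` such that the local
kernels `LK_w = ker (H¹(D_w, M) → H¹(D_w ∩ Gal(K̄/K_∞), M))` VANISH at every finite `w ∤ p` outside `T` and at every infinite place and are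
FINITE at `w ∈ T` and at `𝔮`: the relative index `[𝔖_𝔮(K_∞, M)^Γ : res 𝔖_𝔮(K, M)]` is NON-ZERO (the quotient is finite). Same construction as
LEAD g11's `relIndex_le_prod_natCard_localKer` (p658316) — lifts `A = res⁻¹(𝔖^Γ)` (every invariant class lifts, Greenberg Lemma 3.2), the
local-class map `A → ∏_{w ∈ T} LK_w × LK_𝔮` with kernel `𝔖_𝔮(K, M)` — ending with `AddSubgroup.finiteIndex_of_le` instead of an inequality.
[cite: GreenbergLNM1716, §3 Lemmas 3.2–3.3 (pp. 86–88)] [cite: Agboola2007, §3 Prop. 3.2 (arXiv p0008:L128–135, L197)] -/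
theorem relIndex_ne_zero_of_localKer_finite {γ : absoluteGaloisGroup K} (hγ : κ.IsTopGenerator γ)
    (hcont : ∀ m : M, Continuous fun g : absoluteGaloisGroup K ↦ g • m) (hprim : ∀ m : M, ∃ k : ℕ, p ^ k • m = 0)
    (T : Finset (HeightOneSpectrum (𝓞 K))) (hTp : ∀ w ∈ T, ((p : ℕ) : 𝓞 K) ∉ w.asIdeal)
    (hT0 : ∀ w : HeightOneSpectrum (𝓞 K), ((p : ℕ) : 𝓞 K) ∉ w.asIdeal → w ∉ T →
      (resOfLe M (inf_le_inf_right (decomp w) (le_top : κ.kerSubgroup ≤ ⊤))).ker = ⊥)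
    (hinf : ∀ w : InfinitePlace K, (resOfLe M (inf_le_inf_right (decompInf w) (le_top : κ.kerSubgroup ≤ ⊤))).ker = ⊥)
    (hfinT : ∀ w ∈ T, Finite (resOfLe M (inf_le_inf_right (decomp w) (le_top : κ.kerSubgroup ≤ ⊤))).ker)
    (hfinq : Finite (resOfLe M (inf_le_inf_right (decomp 𝔮) (le_top : κ.kerSubgroup ≤ ⊤))).ker) :
    (((restrictedSelmerBase M p 𝔮).map (resOfLe M (le_top : κ.kerSubgroup ≤ ⊤))).addSubgroupOf
        (restrictedSelmerZp κ M 𝔮)).relIndex (endInvariants (conjRestricted κ M 𝔮 γ - 1)) ≠ 0 := by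
  -- notation
  set H := κ.kerSubgroup with hHdef
  set f : subgroupH1 (⊤ : Subgroup (absoluteGaloisGroup K)) M →+ subgroupH1 H M := resOfLe M (le_top : H ≤ ⊤) with hfdef
  set S := restrictedSelmerZp κ M 𝔮 with hSdef
  set E : AddSubgroup S := endInvariants (conjRestricted κ M 𝔮 γ - 1) with hEdef
  set SK := restrictedSelmerBase M p 𝔮 with hSKdef
  -- the subgroup `A` of lifts of invariant classes: `A = f⁻¹(E)`
  set A : AddSubgroup (subgroupH1 (⊤ : Subgroup (absoluteGaloisGroup K)) M) := (E.map S.subtype).comap f with hAdef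
  have hAS : ∀ x ∈ A, f x ∈ S := by
    rintro x ⟨e, -, hex⟩
    rw [← hex]; exact e.2
  have hAE : ∀ (x) (hx : x ∈ A), (⟨f x, hAS x hx⟩ : S) ∈ E := by
    rintro x hx
    obtain ⟨e, he, hex⟩ := hx
    have : (⟨f x, hAS x ⟨e, he, hex⟩⟩ : S) = e := Subtype.ext hex.symm
    rw [this]; exact he
  have hmemA : ∀ (x) (hS : f x ∈ S), (⟨f x, hS⟩ : S) ∈ E → x ∈ A := fun x hS hE ↦ ⟨⟨f x, hS⟩, hE, rfl⟩
  -- `SK ≤ A`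
  have hSKA : SK ≤ A := by
    intro c hc
    refine hmemA c (resOfLe_mem_restrictedSelmer M p 𝔮 le_top hc) ?_
    rw [hEdef, mem_endInvariants_conjRestricted_iff]
    exact conjH1_resOfLe_of_mem M (le_top : H ≤ ⊤) (Subgroup.mem_top γ) c
  -- the map `g : A → E`, onto
  let g : A →+ E :=
    { toFun := fun x ↦ ⟨⟨f x, hAS x x.2⟩, hAE x x.2⟩
      map_zero' := Subtype.ext (Subtype.ext (by simp only [ZeroMemClass.coe_zero, map_zero]))
      map_add' := fun a b ↦ Subtype.ext (Subtype.ext (by simp only [AddSubgroup.coe_add, map_add])) }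
  have hg : Function.Surjective g := by
    intro y
    obtain ⟨x, hx⟩ := exists_resOfLe_top_eq_of_mem_endInvariants κ M 𝔮 hγ hcont hprim (y := (y : S)) y.2
    have hxS : f x ∈ S := by rw [hfdef, hx]; exact (y : S).2
    have hxA : x ∈ A := hmemA x hxS (by
      have : (⟨f x, hxS⟩ : S) = (y : S) := Subtype.ext hx
      rw [this]; exact y.2)
    exact ⟨⟨x, hxA⟩, Subtype.ext (Subtype.ext hx)⟩
  -- `B := SK` inside `A`, and its image under `g` lies in the image of `SK` inside `E`
  set B : AddSubgroup A := SK.addSubgroupOf A with hBdef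
  have hBg : B.map g ≤ ((SK.map f).addSubgroupOf S).addSubgroupOf E := by
    rintro _ ⟨x, hxB, rfl⟩
    rw [AddSubgroup.mem_addSubgroupOf, AddSubgroup.mem_addSubgroupOf]
    exact ⟨(x : subgroupH1 ⊤ M), AddSubgroup.mem_addSubgroupOf.mp hxB, rfl⟩
  -- the local-class map `φ : A → (∏_{w ∈ T} LK_w) × LK_𝔮`, kernel `B`
  let LK : (w : HeightOneSpectrum (𝓞 K)) →
      AddSubgroup (subgroupH1 ((⊤ : Subgroup (absoluteGaloisGroup K)) ⊓ decomp w) M) := fun w ↦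
    (resOfLe M (inf_le_inf_right (decomp w) (le_top : H ≤ ⊤))).ker
  have hloc : ∀ (x : A) (w : HeightOneSpectrum (𝓞 K)), ((p : ℕ) : 𝓞 K) ∉ w.asIdeal ∨ w = 𝔮 →
      resOfLe M (inf_le_left : ⊤ ⊓ decomp w ≤ ⊤) (x : subgroupH1 ⊤ M) ∈ LK w := by
    intro x w hw
    obtain ⟨hfin', -, hq⟩ := resOfLe_decomp_mem_localKer_of_mem κ M 𝔮 (hAS x x.2)
    rcases hw with hw | rfl
    · exact hfin' w hw
    · exact hq
  let G := subgroupH1 (⊤ : Subgroup (absoluteGaloisGroup K)) M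
  let locw : (w : HeightOneSpectrum (𝓞 K)) →
      (G →+ subgroupH1 ((⊤ : Subgroup (absoluteGaloisGroup K)) ⊓ decomp w) M) := fun w ↦
    resOfLe M (inf_le_left : ⊤ ⊓ decomp w ≤ ⊤)
  let φ : A →+ (Π w : ↥T, LK (w : HeightOneSpectrum (𝓞 K))) × LK 𝔮 :=
    { toFun := fun x ↦ (fun w ↦ ⟨locw w (x : G), hloc x w (Or.inl (hTp w w.2))⟩, ⟨locw 𝔮 (x : G), hloc x 𝔮 (Or.inr rfl)⟩)
      map_zero' := by
        refine Prod.ext (funext fun w ↦ Subtype.ext ?_) (Subtype.ext ?_)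
        · show locw w ((0 : A) : G) = ((0 : LK (w : HeightOneSpectrum (𝓞 K))) :
            subgroupH1 ((⊤ : Subgroup (absoluteGaloisGroup K)) ⊓ decomp (w : HeightOneSpectrum (𝓞 K))) M)
          rw [ZeroMemClass.coe_zero, map_zero, ZeroMemClass.coe_zero]
        · show locw 𝔮 ((0 : A) : G) = ((0 : LK 𝔮) : subgroupH1 ((⊤ : Subgroup (absoluteGaloisGroup K)) ⊓ decomp 𝔮) M)
          rw [ZeroMemClass.coe_zero, map_zero, ZeroMemClass.coe_zero]
      map_add' := fun a b ↦ by
        refine Prod.ext (funext fun w ↦ Subtype.ext ?_) (Subtype.ext ?_)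
        · show locw w ((a : G) + (b : G)) = locw w (a : G) + locw w (b : G)
          exact map_add _ _ _
        · show locw 𝔮 ((a : G) + (b : G)) = locw 𝔮 (a : G) + locw 𝔮 (b : G)
          exact map_add _ _ _ }
  have hφ1 : ∀ (x : A) (w : ↥T), (((φ x).1 w : LK (w : HeightOneSpectrum (𝓞 K))) :
      subgroupH1 ((⊤ : Subgroup (absoluteGaloisGroup K)) ⊓ decomp (w : HeightOneSpectrum (𝓞 K))) M) =
      resOfLe M (inf_le_left : ⊤ ⊓ decomp (w : HeightOneSpectrum (𝓞 K)) ≤ ⊤) (x : G) := fun _ _ ↦ rfl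
  have hφ2 : ∀ x : A, (((φ x).2 : LK 𝔮) : subgroupH1 ((⊤ : Subgroup (absoluteGaloisGroup K)) ⊓ decomp 𝔮) M) =
      resOfLe M (inf_le_left : ⊤ ⊓ decomp 𝔮 ≤ ⊤) (x : G) := fun _ ↦ rfl
  have hkerφ : φ.ker = B := by
    ext x
    rw [AddMonoidHom.mem_ker, hBdef, AddSubgroup.mem_addSubgroupOf,
      mem_restrictedSelmerBase_iff_of_localKer_eq_bot κ M 𝔮 T hT0 hinf (hAS x x.2)]
    constructor
    · intro h0
      refine ⟨fun w hwT _ ↦ ?_, ?_⟩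
      · rw [← hφ1 x ⟨w, hwT⟩, h0]; rfl
      · rw [← hφ2 x, h0]; rfl
    · rintro ⟨h1, h2⟩
      refine Prod.ext (funext fun w ↦ Subtype.ext ?_) (Subtype.ext ?_)
      · rw [hφ1]; exact h1 w w.2 (hTp w w.2)
      · rw [hφ2]; exact h2
  -- counting
  haveI hfinP : Finite ((Π w : ↥T, LK (w : HeightOneSpectrum (𝓞 K))) × LK 𝔮) := by
    haveI : ∀ w : ↥T, Finite (LK (w : HeightOneSpectrum (𝓞 K))) := fun w ↦ hfinT w w.2
    haveI := hfinq
    infer_instance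
  -- `B.index = #(A/B) = #range φ`, finite
  have hidx : B.index = Nat.card φ.range := by
    rw [AddSubgroup.index_eq_card, ← hkerφ]
    exact Nat.card_congr (QuotientAddGroup.quotientKerEquivRange φ).toEquiv
  have hBidx0 : B.index ≠ 0 := by
    rw [hidx]
    haveI : Finite φ.range := Finite.of_injective _ Subtype.val_injective
    haveI : Nonempty φ.range := ⟨0⟩
    exact (Nat.card_pos (α := ↥φ.range)).ne'
  -- `(B.map g).index ∣ B.index`
  have hdvd : (B.map g).index ∣ B.index := AddSubgroup.index_map_dvd B hg
  have hmap0 : (B.map g).index ≠ 0 := fun h0 ↦ hBidx0 (Nat.eq_zero_of_zero_dvd (h0 ▸ hdvd))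
  haveI : (B.map g).FiniteIndex := ⟨hmap0⟩
  -- the relative index is the index of a LARGER subgroup of `E`, hence finite (non-zero)
  have hrel : (((SK.map f).addSubgroupOf S).relIndex E) = (((SK.map f).addSubgroupOf S).addSubgroupOf E).index := rfl
  rw [hrel]
  exact (AddSubgroup.finiteIndex_of_le hBg).index_ne_zero

/-- **`𝔖^Γ` is finite as soon as `𝔖_𝔮(K, M)` is** (generic, under the local hypotheses of `relIndex_ne_zero_of_localKer_finite`):
-w7's `finite_endInvariants_of_finite_restrictedSelmerBase` (p652120) fed with the finiteness of the cokernel.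
[cite: Agboola2007, §3 Prop. 3.2, §6] [cite: GreenbergLNM1716, §3 Lemmas 3.1–3.2] -/
theorem finite_endInvariants_of_finite_restrictedSelmerBase_of_localKer_finite {γ : absoluteGaloisGroup K}
    (hγ : κ.IsTopGenerator γ) (hcont : ∀ m : M, Continuous fun g : absoluteGaloisGroup K ↦ g • m)
    (hprim : ∀ m : M, ∃ k : ℕ, p ^ k • m = 0)
    (T : Finset (HeightOneSpectrum (𝓞 K))) (hTp : ∀ w ∈ T, ((p : ℕ) : 𝓞 K) ∉ w.asIdeal)
    (hT0 : ∀ w : HeightOneSpectrum (𝓞 K), ((p : ℕ) : 𝓞 K) ∉ w.asIdeal → w ∉ T →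
      (resOfLe M (inf_le_inf_right (decomp w) (le_top : κ.kerSubgroup ≤ ⊤))).ker = ⊥)
    (hinf : ∀ w : InfinitePlace K, (resOfLe M (inf_le_inf_right (decompInf w) (le_top : κ.kerSubgroup ≤ ⊤))).ker = ⊥)
    (hfinT : ∀ w ∈ T, Finite (resOfLe M (inf_le_inf_right (decomp w) (le_top : κ.kerSubgroup ≤ ⊤))).ker)
    (hfinq : Finite (resOfLe M (inf_le_inf_right (decomp 𝔮) (le_top : κ.kerSubgroup ≤ ⊤))).ker)
    (hB : Finite (restrictedSelmerBase M p 𝔮)) :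
    Finite (endInvariants (conjRestricted κ M 𝔮 γ - 1)) :=
  finite_endInvariants_of_finite_restrictedSelmerBase κ M 𝔮 γ hB
    (relIndex_ne_zero_of_localKer_finite κ M 𝔮 hγ hcont hprim T hTp hT0 hinf hfinT hfinq)

end Coker

/-! ## §2 Road α: every S3c frame -/

section Frame

open Summit.BirchSwinnertonDyer.BirchSwinnertonDyer.Theorems.PrintCf2.ReductionTypesOverK

variable {K : Type} [Field K] [NumberField K]

/-- **The control cokernel is finite on every S3c frame**: `[𝔖_{v̄}(K*_∞, W*)^Γ : res 𝔖_{v̄}(K, W*)] ≠ 0` for every member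
`C • W = cm7^{(d)}` (`d ≠ 0` squarefree), `K` imaginary quadratic with `v ≠ v̄ ∣ 2`, `π² = π − 2`, `r² = r − 2`, `κ'` unramified outside
`v̄` with topological generator `γ'`. Local inputs: the kernels vanish at good `w ∤ 2` (-w3 g7 `localKer_top_of_frame_eq_bot`: `7d ∉ w`), are
finite at `w ∣ 7d`, `w ∤ 2` (`finite_and_natCard_localKer_top_of_frame_le_two`) and at `v̄` (`finite_and_natCard_localKer_top_vbar_of_frame_le_four`),
and vanish at infinity (`K` totally complex, LEAD g11 p658763); `T = {w : 2 ∉ w, 7d ∈ w}` exists (`exists_finset_seven_mul`).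
[cite: Agboola2007, §3 Prop. 3.2, §6] [cite: GreenbergLNM1716, §3 Lemmas 3.2–3.3] -/
theorem relIndex_control_of_frame_ne_zero {d : ℤ} (hd0 : d ≠ 0) (hsq : Squarefree d)
    (W : WeierstrassCurve ℚ) [W.IsElliptic] (C : VariableChange ℚ) (hC : C • W = cm7.quadraticTwist (d : ℚ))
    (hK : IsImaginaryQuadratic K) {v vbar : HeightOneSpectrum (𝓞 K)} (hv : ((2 : ℕ) : 𝓞 K) ∈ v.asIdeal)
    (hvbar : ((2 : ℕ) : 𝓞 K) ∈ vbar.asIdeal) (hne : vbar ≠ v) (π : (W.baseChange K).endRing)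
    (hrel : (π : AddMonoid.End (W.baseChange K).geomPoints) * π = π - 2) {r : ℤ_[2]} (hr : r * r = r - 2)
    (κ' : ZpExtension K 2) (hκ' : κ'.IsUnramifiedOutside vbar) {γ' : absoluteGaloisGroup K} (hγ' : κ'.IsTopGenerator γ') :
    (((restrictedSelmerBase ↥((W.baseChange K).endEigenPrimaryTorsion 2 π r) 2 vbar).map
        (resOfLe ↥((W.baseChange K).endEigenPrimaryTorsion 2 π r) (le_top : κ'.kerSubgroup ≤ ⊤))).addSubgroupOf
        (restrictedSelmerZp κ' ↥((W.baseChange K).endEigenPrimaryTorsion 2 π r) vbar)).relIndex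
      (endInvariants (conjRestricted κ' ↥((W.baseChange K).endEigenPrimaryTorsion 2 π r) vbar γ' - 1)) ≠ 0 := by
  haveI : (W.baseChange K).IsElliptic := by rw [baseChange]; infer_instance
  set M := ↥((W.baseChange K).endEigenPrimaryTorsion 2 π r) with hM
  obtain ⟨T, hT⟩ := exists_finset_seven_mul (K := K) hd0
  have hTp : ∀ w ∈ T, ((2 : ℕ) : 𝓞 K) ∉ w.asIdeal := fun w hw ↦ ((hT w).mp hw).1
  have hT0 : ∀ w : HeightOneSpectrum (𝓞 K), ((2 : ℕ) : 𝓞 K) ∉ w.asIdeal → w ∉ T →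
      (resOfLe M (inf_le_inf_right (decomp w) (le_top : κ'.kerSubgroup ≤ ⊤))).ker = ⊥ := by
    intro w h2w hwT
    have h7d : ((7 * d : ℤ) : 𝓞 K) ∉ w.asIdeal := fun h ↦ hwT ((hT w).mpr ⟨h2w, h⟩)
    exact localKer_top_of_frame_eq_bot hd0 W C hC vbar hvbar π hrel hr κ' hκ' h2w h7d
  have hfinT : ∀ w ∈ T, Finite (resOfLe M (inf_le_inf_right (decomp w) (le_top : κ'.kerSubgroup ≤ ⊤))).ker :=
    fun w hw ↦ (finite_and_natCard_localKer_top_of_frame_le_two hd0 hsq W C hC hK vbar hvbar π hrel hr κ' hκ'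
      ((hT w).mp hw).1 ((hT w).mp hw).2).1
  obtain ⟨hfinq, -⟩ := finite_and_natCard_localKer_top_vbar_of_frame_le_four hd0 W C hC hK hv hvbar hne π hrel hr κ'
  exact relIndex_ne_zero_of_localKer_finite κ' M vbar hγ'
    (continuous_smul_endEigenPrimaryTorsion (W.baseChange K) 2 π r)
    (exists_pow_smul_endEigenPrimaryTorsion_eq_zero (W.baseChange K) 2 π r) T hTp hT0
    (localKer_decompInf_eq_bot_of_isImaginaryQuadratic κ' M hK) hfinT hfinq

/-- **On every S3c frame, `𝔖_{v̄}(K*_∞, W*)^Γ` is finite as soon as `𝔖_{v̄}(K, W*)` is** — the finiteness conjunct of v9.1–v10.2's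
S3c₂ `stub_restrictedEulerCharBottom_two` REDUCED to the level-`K` finiteness (Agboola §6: in `O_K`-rank one with `Ш(K)(v̄)` finite and
`log_{v̄} P ≠ 0`, Prop. 6.10–6.11 via Cassels–Poitou–Tate). [cite: Agboola2007, §3 Prop. 3.2, §6 Prop. 6.10–6.11] [cite: GreenbergLNM1716, §3] -/
theorem finite_endInvariants_of_frame_of_finite_restrictedSelmerBase {d : ℤ} (hd0 : d ≠ 0) (hsq : Squarefree d)
    (W : WeierstrassCurve ℚ) [W.IsElliptic] (C : VariableChange ℚ) (hC : C • W = cm7.quadraticTwist (d : ℚ))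
    (hK : IsImaginaryQuadratic K) {v vbar : HeightOneSpectrum (𝓞 K)} (hv : ((2 : ℕ) : 𝓞 K) ∈ v.asIdeal)
    (hvbar : ((2 : ℕ) : 𝓞 K) ∈ vbar.asIdeal) (hne : vbar ≠ v) (π : (W.baseChange K).endRing)
    (hrel : (π : AddMonoid.End (W.baseChange K).geomPoints) * π = π - 2) {r : ℤ_[2]} (hr : r * r = r - 2)
    (κ' : ZpExtension K 2) (hκ' : κ'.IsUnramifiedOutside vbar) {γ' : absoluteGaloisGroup K} (hγ' : κ'.IsTopGenerator γ')
    (hB : Finite (restrictedSelmerBase ↥((W.baseChange K).endEigenPrimaryTorsion 2 π r) 2 vbar)) :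
    Finite (endInvariants (conjRestricted κ' ↥((W.baseChange K).endEigenPrimaryTorsion 2 π r) vbar γ' - 1)) :=
  finite_endInvariants_of_finite_restrictedSelmerBase κ' _ vbar γ' hB
    (relIndex_control_of_frame_ne_zero hd0 hsq W C hC hK hv hvbar hne π hrel hr κ' hκ' hγ')

end Frame

end Summit.BirchSwinnertonDyer.BirchSwinnertonDyer.Theorems.PrintCf2.RestrictedSelmerPair

end
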